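import Summits.QuantumAdvantage.QuantumAdvantage.Theorems.SosSandwichPseudoBoundedAAGradientBound
import Literature.Computability.QuantumComplexity.BlockSensitivityQuantumBound
import HarnessLib

/-!
# Route `SosSandwich`, crux `PseudoBoundedAA` (stmt-QuantumAdvantage-15237): ℓ¹ BLOCK sensitivity of bounded low-degree
# functions is `O(d²)` — Nisan–Szegedy's `bs ≤ O(deg²)` for real-valued bounded polynomials, with constant

`Theorems/SosSandwichPseudoBoundedAAGradientBound.lean` bounds the ℓ¹-sensitivity `Σ_i |g(x) - g(x^{⊕i})| ≤ 4d²M` of an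
`M`-bounded function of Fourier degree `≤ d` at every vertex.  This file upgrades single bits to DISJOINT BLOCKS:
for pairwise disjoint `B_1, …, B_k ⊆ [N]` and every vertex `x`,
`Σ_j |g(x) - g(x^{⊕B_j})| ≤ 4d²M` (`sum_abs_sub_blockFlip_le`), where `x^{⊕B}` flips the coordinates in `B`.
Proof: the block-flip parametrisation `y ↦ g(x ⊕ Σ_j y_j 1_{B_j})` is a function of `k` bits of Fourier degree `≤ d`
(`isLevelLE_blockFlip`: `χ_T(x ⊕ ·) = χ_T(x) · χ_{S_T}` with `S_T = {j : |T ∩ B_j| odd}`, `|S_T| ≤ |T|` by disjointness —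
`walsh_blockFlip`, `card_filter_odd_le`), still `M`-bounded, and its single-bit flips at `y = 0` are exactly the block
flips of `g` at `x`; apply the ℓ¹-sensitivity bound on `{0,1}^k`.

By name (§3): `blockSensitivity_le_two_mul_degree_sq` — the tree's `blockSensitivity f ≤ 2·d²` for every Boolean `f` with an
exact representing polynomial of total degree `≤ d` (Nisan–Szegedy 1994, `deg(f) ≥ √(bs(f)/2)`; the tree had the
bounded-error form with constant `4`).

Consequences: `[0,1]`-valued `p` of total degree `≤ d`: `Σ_j |p(x) - p(x^{⊕B_j})| ≤ 2d²` (`sum_abs_sub_blockFlip_le_of_bounded`;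
for Boolean-valued `p` this is `bs(p) ≤ 2·deg(p)²`, the Nisan–Szegedy block-sensitivity bound with constant `2`); on `K_T`
and on `Q_T`: `≤ 8T²` (`…_pseudoBounded`, `…_query`) — the acceptance probability of a `T`-query quantum algorithm moves by
at most `8T²` in total over any family of disjoint block flips of any input.

Honest label: support lemmas (structural inequality); no stub, crux or summit is proved.  Sources: Nisan–Szegedy 1994
(`bs(f) = O(deg(f)²)` via symmetrisation + Markov); Korneichuk 1991 Thm. 3.5.8; O'Donnell 2014 §1.4, §2.2; Beals et al. 2001
Lemma 4.2.
-/

-- D-0017: single-conjunct summit ⇒ the duplicate `QuantumAdvantage.QuantumAdvantage` is mandated.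
set_option linter.dupNamespace false

noncomputable section

namespace Summit.QuantumAdvantage.QuantumAdvantage.Theorems.SosSandwich.BlockSensitivity

open Finset
open Literature.Computability.QuantumComplexity
open Literature.Computability.Complexity.LowDegree (cubeFourierCoeff sum_cubeFourierCoeff_mul_walsh IsLevelLE
  isLevelLE_walsh isLevelLE_zero)
open Literature.Probability.RandomGraphs.LowDegree (sgn walsh sgn_true sgn_false walsh_empty)
open Literature.Computability.Cryptography (QQueryAlg)
open Summit.QuantumAdvantage.QuantumAdvantage.Theorems.SosSandwich.GradientBound

variable {N k : ℕ}

/-! ### §1 Characters under the block-flip parametrisation -/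

/-- `χ(b)^n` depends only on the parity of `n`. [folklore] -/
theorem sgn_pow_eq_ite (b : Bool) (n : ℕ) : sgn b ^ n = if Odd n then sgn b else 1 := by
  cases b
  · simp [sgn]
  · rcases Nat.even_or_odd n with h | h
    · rw [if_neg (Nat.not_odd_iff_even.mpr h), sgn_true, h.neg_one_pow]
    · rw [if_pos h, sgn_true, h.neg_one_pow]

/-- For pairwise disjoint blocks, "coordinate `i` is flipped" is decided by the (at most one) block containing `i`:
`χ([∃ j, i ∈ B_j ∧ y_j]) = Π_j (i ∈ B_j ? χ(y_j) : 1)`. [folklore] -/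
theorem sgn_decide_exists_eq_prod (B : Fin k → Finset (Fin N)) (hB : ∀ j j', j ≠ j' → Disjoint (B j) (B j'))
    (y : Fin k → Bool) (i : Fin N) :
    sgn (decide (∃ j, i ∈ B j ∧ y j = true)) = ∏ j, (if i ∈ B j then sgn (y j) else 1) := by
  classical
  by_cases h : ∃ j, i ∈ B j
  · obtain ⟨j₀, hj₀⟩ := h
    have huniq : ∀ j, i ∈ B j → j = j₀ := fun j hj => by
      by_contra hne
      exact Finset.disjoint_left.mp (hB j j₀ hne) hj hj₀
    have hiff : (∃ j, i ∈ B j ∧ y j = true) ↔ y j₀ = true :=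
      ⟨fun ⟨j, hj, hyj⟩ => huniq j hj ▸ hyj, fun hy => ⟨j₀, hj₀, hy⟩⟩
    rw [Finset.prod_eq_single j₀ (fun j _ hj => if_neg (fun hij => hj (huniq j hij)))
      (fun h0 => absurd (Finset.mem_univ _) h0), if_pos hj₀]
    simp only [hiff, Bool.decide_eq_true]
  · push Not at h
    have hF : ¬ (∃ j, i ∈ B j ∧ y j = true) := fun ⟨j, hj, _⟩ => h j hj
    rw [decide_eq_false hF, sgn_false]
    exact (Finset.prod_eq_one fun j _ => if_neg (h j)).symm

/-- **Characters factor under block flips**: `χ_T(x ⊕ Σ_j y_j 1_{B_j}) = χ_T(x) · χ_{S_T}(y)` with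
`S_T = {j : |T ∩ B_j| odd}` (pairwise disjoint blocks). [cite: ODonnell2014, §1.4 (characters are multiplicative)] -/
theorem walsh_blockFlip (B : Fin k → Finset (Fin N)) (hB : ∀ j j', j ≠ j' → Disjoint (B j) (B j'))
    (x : Fin N → Bool) (y : Fin k → Bool) (T : Finset (Fin N)) :
    walsh T (fun i => xor (x i) (decide (∃ j, i ∈ B j ∧ y j = true))) =
      walsh T x * walsh (univ.filter fun j => Odd (T ∩ B j).card) y := by
  classical
  -- `χ(a ⊕ b) = χ(a) χ(b)` (the tree's `LowDegree.sgn_xor`, inlined to keep the import cone small)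
  have hx : ∀ a b : Bool, sgn (xor a b) = sgn a * sgn b := fun a b => by cases a <;> cases b <;> simp [sgn]
  unfold walsh
  simp_rw [hx]
  rw [Finset.prod_mul_distrib]
  congr 1
  simp_rw [sgn_decide_exists_eq_prod B hB y]
  rw [Finset.prod_comm, Finset.prod_filter]
  refine Finset.prod_congr rfl fun j _ => ?_
  rw [Finset.prod_ite_mem, Finset.prod_const, sgn_pow_eq_ite]

/-- At most `|T|` blocks meet `T` in an odd number of points (pairwise disjoint blocks). [folklore] -/
theorem card_filter_odd_le (B : Fin k → Finset (Fin N)) (hB : ∀ j j', j ≠ j' → Disjoint (B j) (B j'))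
    (T : Finset (Fin N)) : (univ.filter fun j : Fin k => Odd (T ∩ B j).card).card ≤ T.card := by
  classical
  have hdisj : (↑(Finset.univ : Finset (Fin k)) : Set (Fin k)).PairwiseDisjoint (fun j => T ∩ B j) :=
    fun j _ j' _ hne => by
      show Disjoint (T ∩ B j) (T ∩ B j')
      exact Disjoint.mono Finset.inter_subset_right Finset.inter_subset_right (hB j j' hne)
  calc (univ.filter fun j : Fin k => Odd (T ∩ B j).card).card
      = ∑ j ∈ univ.filter (fun j : Fin k => Odd (T ∩ B j).card), 1 := by simp
    _ ≤ ∑ j ∈ univ.filter (fun j : Fin k => Odd (T ∩ B j).card), (T ∩ B j).card :=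
        Finset.sum_le_sum fun j hj => (Finset.mem_filter.1 hj).2.pos
    _ ≤ ∑ j, (T ∩ B j).card :=
        Finset.sum_le_sum_of_subset_of_nonneg (Finset.filter_subset _ _) fun _ _ _ => Nat.zero_le _
    _ = (Finset.univ.biUnion fun j => T ∩ B j).card := (Finset.card_biUnion hdisj).symm
    _ ≤ T.card := Finset.card_le_card (Finset.biUnion_subset.mpr fun j _ => Finset.inter_subset_left)

/-- **The block-flip parametrisation preserves Fourier degree**: if `g` has Fourier degree `≤ d` on `{0,1}^N`, then
`y ↦ g(x ⊕ Σ_j y_j 1_{B_j})` has Fourier degree `≤ d` on `{0,1}^k`. [cite: ODonnell2014, §1.4] -/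
theorem isLevelLE_blockFlip {d : ℕ} {g : (Fin N → Bool) → ℝ} (hdeg : IsLevelLE d g)
    (B : Fin k → Finset (Fin N)) (hB : ∀ j j', j ≠ j' → Disjoint (B j) (B j')) (x : Fin N → Bool) :
    IsLevelLE d (fun y : Fin k → Bool => g (fun i => xor (x i) (decide (∃ j, i ∈ B j ∧ y j = true)))) := by
  classical
  have hexp : (fun y : Fin k → Bool => g (fun i => xor (x i) (decide (∃ j, i ∈ B j ∧ y j = true)))) =
      fun y => ∑ T : Finset (Fin N), (cubeFourierCoeff g T * walsh T x) *
        walsh (univ.filter fun j => Odd (T ∩ B j).card) y := by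
    funext y
    rw [← sum_cubeFourierCoeff_mul_walsh g (fun i => xor (x i) (decide (∃ j, i ∈ B j ∧ y j = true)))]
    exact Finset.sum_congr rfl fun T _ => by rw [walsh_blockFlip B hB x y T]; ring
  rw [hexp]
  refine IsLevelLE.sum _ fun T _ => ?_
  by_cases hT : d < T.card
  · have h0 : (fun y : Fin k → Bool => cubeFourierCoeff g T * walsh T x *
        walsh (univ.filter fun j => Odd (T ∩ B j).card) y) = fun _ => (0 : ℝ) := by
      funext y; rw [hdeg T hT]; ring
    rw [h0]
    exact isLevelLE_zero d
  · exact (isLevelLE_walsh _ ((card_filter_odd_le B hB T).trans (Nat.le_of_not_lt hT))).const_mul _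

/-! ### §2 The ℓ¹ block-sensitivity bound -/

/-- No block flipped: `x ⊕ 0 = x`. [folklore] -/
theorem blockFlip_zero (B : Fin k → Finset (Fin N)) (x : Fin N → Bool) :
    (fun i => xor (x i) (decide (∃ j, i ∈ B j ∧ (fun _ : Fin k => false) j = true))) = x := by
  funext i
  simp

/-- Flipping bit `j` of `y = 0` flips exactly block `B_j`. [folklore] -/
theorem blockFlip_flipBit_zero (B : Fin k → Finset (Fin N)) (x : Fin N → Bool) (j : Fin k) :
    (fun i => xor (x i) (decide (∃ j', i ∈ B j' ∧ (flipBit j (fun _ : Fin k => false)) j' = true))) =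
      fun i => xor (x i) (decide (i ∈ B j)) := by
  funext i
  have hiff : (∃ j', i ∈ B j' ∧ (flipBit j (fun _ : Fin k => false)) j' = true) ↔ i ∈ B j := by
    constructor
    · rintro ⟨j', hj', hy⟩
      by_cases e : j' = j
      · exact e ▸ hj'
      · rw [flipBit, Function.update_of_ne e] at hy
        exact absurd hy Bool.false_ne_true
    · intro hi
      exact ⟨j, hi, by simp [flipBit]⟩
  simp only [hiff]

/-- **ℓ¹ block sensitivity is `O(d²)`**: for an `M`-bounded `g` of Fourier degree `≤ d`, pairwise disjoint blocks
`B_1, …, B_k` and every vertex `x`, `Σ_j |g(x) - g(x^{⊕B_j})| ≤ 4d²M` (`x^{⊕B}` flips the coordinates in `B`).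
[cite: Korneichuk1991, Thm 3.5.8 (§3.5.4)] [cite: ODonnell2014, §1.4, §2.2] -/
theorem sum_abs_sub_blockFlip_le {d : ℕ} {M : ℝ} {g : (Fin N → Bool) → ℝ} (hdeg : IsLevelLE d g)
    (hM : ∀ z, |g z| ≤ M) (B : Fin k → Finset (Fin N)) (hB : ∀ j j', j ≠ j' → Disjoint (B j) (B j'))
    (x : Fin N → Bool) :
    ∑ j, |g x - g (fun i => xor (x i) (decide (i ∈ B j)))| ≤ 4 * (d : ℝ) ^ 2 * M := by
  have h := sum_abs_sub_flipBit_le (isLevelLE_blockFlip hdeg B hB x) (fun y => hM _) (fun _ : Fin k => false)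
  have e0 := congrArg g (blockFlip_zero B x)
  have e1 : ∀ j, g (fun i => xor (x i) (decide (∃ j', i ∈ B j' ∧ (flipBit j (fun _ : Fin k => false)) j' = true))) =
      g (fun i => xor (x i) (decide (i ∈ B j))) := fun j => congrArg g (blockFlip_flipBit_zero B x j)
  simp only [e0, e1] at h
  exact h

/-- **ℓ¹ block sensitivity of a `[0,1]`-valued polynomial of total degree `≤ d`**: `Σ_j |p(x) - p(x^{⊕B_j})| ≤ 2d²` for
pairwise disjoint blocks at every vertex (for Boolean-valued `p`: `bs(p) ≤ 2·deg(p)²`). [cite: Korneichuk1991, Thm 3.5.8 (§3.5.4)]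
[cite: ODonnell2014, §2.2] -/
theorem sum_abs_sub_blockFlip_le_of_bounded {d : ℕ} {p : MvPolynomial (Fin N) ℝ} (hp : p.totalDegree ≤ d)
    (hb : ∀ x, 0 ≤ evalBool p x ∧ evalBool p x ≤ 1) (B : Fin k → Finset (Fin N))
    (hB : ∀ j j', j ≠ j' → Disjoint (B j) (B j')) (x : Fin N → Bool) :
    ∑ j, |evalBool p x - evalBool p (fun i => xor (x i) (decide (i ∈ B j)))| ≤ 2 * (d : ℝ) ^ 2 := by
  have hdeg : IsLevelLE d (fun y => evalBool p y - 1 / 2) := fun S hS => by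
    have hS0 : S ≠ ∅ := by rintro rfl; simp at hS
    rw [LevelOneRung.cubeFourierCoeff_sub_const _ hS0]
    exact cubeFourierCoeff_evalBool_eq_zero hp hS
  have hM : ∀ y, |evalBool p y - 1 / 2| ≤ 1 / 2 := fun y => by
    rw [abs_le]; constructor <;> linarith [(hb y).1, (hb y).2]
  have h := sum_abs_sub_blockFlip_le hdeg hM B hB x
  have e : ∀ j, |(fun y => evalBool p y - 1 / 2) x -
      (fun y => evalBool p y - 1 / 2) (fun i => xor (x i) (decide (i ∈ B j)))| =
      |evalBool p x - evalBool p (fun i => xor (x i) (decide (i ∈ B j)))| := fun j => by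
    congr 1; ring
  simp only [e] at h
  linarith

/-- **On `K_T`**: `Σ_j |p(x) - p(x^{⊕B_j})| ≤ 8T²` for every pseudo-bounded `p` of order `T`, pairwise disjoint blocks and
every vertex. [cite: KaniewskiLeeDewolf2015, Def. 7] [cite: Korneichuk1991, Thm 3.5.8 (§3.5.4)] -/
theorem sum_abs_sub_blockFlip_le_pseudoBounded {T : ℕ} {p : MvPolynomial (Fin N) ℝ} (h : PseudoBounded T p)
    (B : Fin k → Finset (Fin N)) (hB : ∀ j j', j ≠ j' → Disjoint (B j) (B j')) (x : Fin N → Bool) :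
    ∑ j, |evalBool p x - evalBool p (fun i => xor (x i) (decide (i ∈ B j)))| ≤ 8 * (T : ℝ) ^ 2 := by
  obtain ⟨p', hdeg, hb, heq⟩ := exists_representative_of_pseudoBounded h
  have h1 := sum_abs_sub_blockFlip_le_of_bounded hdeg hb B hB x
  rw [heq] at h1
  have e : (2 : ℝ) * ((2 * T : ℕ) : ℝ) ^ 2 = 8 * (T : ℝ) ^ 2 := by push_cast; ring
  linarith

/-- **On `Q_T`**: the acceptance probability of a `T`-query quantum algorithm moves by at most `8T²` in total over any
family of pairwise disjoint block flips of any input: `Σ_j |p(x) - p(x^{⊕B_j})| ≤ 8T²`. [cite: BealsEtAl2001, Lemma 4.2]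
[cite: Korneichuk1991, Thm 3.5.8 (§3.5.4)] -/
theorem sum_abs_sub_blockFlip_le_query (Q : QQueryAlg N) (p : MvPolynomial (Fin N) ℝ)
    (hp : ∀ x, evalBool p x = Q.acceptProb x) (B : Fin k → Finset (Fin N))
    (hB : ∀ j j', j ≠ j' → Disjoint (B j) (B j')) (x : Fin N → Bool) :
    ∑ j, |evalBool p x - evalBool p (fun i => xor (x i) (decide (i ∈ B j)))| ≤ 8 * (Q.queries : ℝ) ^ 2 := by
  obtain ⟨p₀, hdeg, hval⟩ := exists_acceptPolynomial Q
  have heq : evalBool p = evalBool p₀ := funext fun y => by rw [hp y]; exact hval y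
  have hb : ∀ y, 0 ≤ evalBool p₀ y ∧ evalBool p₀ y ≤ 1 := fun y => by
    have hy : evalBool p₀ y = Q.acceptProb y := (hval y).symm
    rw [hy]
    exact ⟨Q.acceptProb_nonneg y, Q.acceptProb_le_one' y⟩
  have h1 := sum_abs_sub_blockFlip_le_of_bounded hdeg hb B hB x
  rw [heq]
  have e : (2 : ℝ) * ((2 * Q.queries : ℕ) : ℝ) ^ 2 = 8 * (Q.queries : ℝ) ^ 2 := by push_cast; ring
  linarith

/-! ### §3 Nisan–Szegedy by name: `bs(f) ≤ 2·deg(f)²` for the tree's `blockSensitivity` -/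

/-- The tree's block flip `x^B` (`Literature.Computability.Complexity.flipBlock`) is the xor form used above. [folklore] -/
theorem flipBlock_eq_xor (x : Fin N → Bool) (B : Finset (Fin N)) :
    Literature.Computability.Complexity.flipBlock x B = fun i => xor (x i) (decide (i ∈ B)) := by
  funext i
  by_cases h : i ∈ B <;> simp [Literature.Computability.Complexity.flipBlock, h]

/-- **Nisan–Szegedy: `deg(f) ≥ √(bs(f)/2)`, i.e. `bs(f) ≤ 2·deg(f)²`** for every Boolean function `f` and every real
polynomial `P` of total degree `≤ d` representing `f` exactly on the cube (`P(z) = [f z]`), with the tree's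
`blockSensitivity` (Beals et al. Def. 4.11).  At the input and disjoint blocks achieving `bs(f)`
(`exists_blocks_of_blockSensitivity`) every block flip changes `P` by exactly `1`, and the ℓ¹ block-sensitivity bound gives
`bs(f) · 1 ≤ 2d²`.  (The tree's `blockSensitivity_le_four_mul_sq_of_approx` is the bounded-error form with constant `4`.)
[cite: NisanSzegedy1994, Lemma 3.8 / Jukna 2012 Thm. 14.11] [cite: BealsEtAl2001, Def 4.11] -/
theorem blockSensitivity_le_two_mul_degree_sq {d : ℕ} (f : (Fin N → Bool) → Bool) (P : MvPolynomial (Fin N) ℝ)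
    (hdeg : P.totalDegree ≤ d) (hP : ∀ z, evalBool P z = if f z then 1 else 0) :
    Literature.Computability.Complexity.blockSensitivity f ≤ 2 * d ^ 2 := by
  classical
  obtain ⟨x, B, hsens, hdisj⟩ := exists_blocks_of_blockSensitivity f
  have hb : ∀ z, 0 ≤ evalBool P z ∧ evalBool P z ≤ 1 := fun z => by
    rw [hP z]; split_ifs <;> norm_num
  have h := sum_abs_sub_blockFlip_le_of_bounded hdeg hb B hdisj x
  have hterm : ∀ j, |evalBool P x - evalBool P (fun i => xor (x i) (decide (i ∈ B j)))| = 1 := by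
    intro j
    have hne := hsens j
    rw [← flipBlock_eq_xor, hP, hP]
    cases hfx : f x <;> cases hfl : f (Literature.Computability.Complexity.flipBlock x (B j)) <;>
      simp [hfx, hfl] at hne ⊢
  simp only [hterm, Finset.sum_const, Finset.card_univ, Fintype.card_fin, nsmul_eq_mul, mul_one] at h
  exact_mod_cast h

end Summit.QuantumAdvantage.QuantumAdvantage.Theorems.SosSandwich.BlockSensitivity

end
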